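import Mathlib
import Summits.Ventures.PercRepro2.Defs
import Summits.Ventures.PercRepro2.CoinDefs
import Summits.Ventures.PercRepro2.CoinInduced
import Summits.Ventures.PercRepro2.CoinLsmCoreDefs
import Summits.Ventures.PercRepro2.CoinOrTailKDefs
import Summits.Ventures.PercRepro2.CoinTreeCore
import Summits.Ventures.PercRepro2.CoinKSureCoins

/-!
# Transport of the one-arc gate along a vertex embedding; row 2′DARC at an OR-tail with
ARBITRARY coins and NO spare-vertex hypothesis (blind cell PercRepro2, night-2 g15;
proofs/NIGHT2-DARC.md §50)

`darc_of_orTailK_coins` (§49.7) splits every non-sure entry coin through a VIRTUAL sure vertex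
and therefore asks for an injective labelling of the entries by vertices outside `U ∪ {a, w}`
(`darc_of_orTailK_coins_card`: a cardinality bound).  The labelling is an artefact of the proof:
the gate functional only sees the coins, so the whole statement is invariant under pushing the
arc map forward along a vertex embedding `f : V ↪ V'` (`mapArcs`): reachability between image
vertices is unchanged (`reach_mapArcs_iff`), the clusters never leave the image
(`reach_mapArcs`), hence the forward / backward / avoidance / gate events and the markers are
the SAME sets of configurations (`gateEvent_mapArcs`, `marker_mapArcs`) and `DARC` transports
both ways (`darc_mapArcs_iff`).  Embedding `V` into `V ⊕ V` (`Function.Embedding.inl`) supplies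
the virtual vertices `Sum.inr r`, and `darc_of_orTailK_coins_any` / `darc_of_orTailTreeK_coins_any`
state row 2′DARC at an OR-tail with ANY entry set, ARBITRARY coin probabilities, every head and
every pair of markers in the core, with NO hypothesis on the vertex type at all.
-/

namespace Summit.Ventures.PercRepro2.Coin

section MapArcs

variable {V V' : Type*} {E : Type*}

/-- The coin system pushed forward along the vertex embedding `f`: every arc `(x, y)` becomes
`(f x, f y)`; the coins (and hence the configurations and their weights) are unchanged. -/
def mapArcs (f : V ↪ V') (arcs : E → Finset (V × V)) : E → Finset (V' × V') :=
  fun e => (arcs e).map (f.prodMap f)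

/-- An arc between image vertices of the pushed-forward system is an arc of the original. -/
lemma mem_mapArcs {f : V ↪ V'} {arcs : E → Finset (V × V)} {e : E} {x y : V} :
    (f x, f y) ∈ mapArcs f arcs e ↔ (x, y) ∈ arcs e := by
  unfold mapArcs
  constructor
  · intro h
    obtain ⟨⟨x', y'⟩, hxy, hf⟩ := Finset.mem_map.1 h
    have hf' : (f x', f y') = (f x, f y) := hf
    simp only [Prod.mk.injEq] at hf'
    rw [f.injective hf'.1, f.injective hf'.2] at hxy
    exact hxy
  · intro h
    exact Finset.mem_map.2 ⟨(x, y), h, rfl⟩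

/-- Every arc of the pushed-forward system joins two image vertices. -/
lemma mem_mapArcs' {f : V ↪ V'} {arcs : E → Finset (V × V)} {e : E} {xy : V' × V'}
    (h : xy ∈ mapArcs f arcs e) : ∃ x y, xy.1 = f x ∧ xy.2 = f y ∧ (x, y) ∈ arcs e := by
  unfold mapArcs at h
  obtain ⟨⟨x, y⟩, hxy, hf⟩ := Finset.mem_map.1 h
  subst hf
  exact ⟨x, y, rfl, rfl, hxy⟩

/-- An open arc out of an image vertex ends at an image vertex and comes from an open arc. -/
lemma openArc_mapArcs {f : V ↪ V'} {arcs : E → Finset (V × V)} {ω : Config E} {x : V}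
    {y' : V'} : OpenArc (mapArcs f arcs) ω (f x) y' ↔ ∃ y, y' = f y ∧ OpenArc arcs ω x y := by
  constructor
  · rintro ⟨e, he, hxy⟩
    obtain ⟨x₁, y₁, hx, hy, harc⟩ := mem_mapArcs' hxy
    refine ⟨y₁, hy, e, he, ?_⟩
    rw [f.injective hx]
    exact harc
  · rintro ⟨y, rfl, e, he, hxy⟩
    exact ⟨e, he, mem_mapArcs.2 hxy⟩

/-- **Clusters never leave the image**: whatever an image vertex reaches in the pushed-forward
system is an image vertex reached in the original. -/
lemma reach_mapArcs {f : V ↪ V'} {arcs : E → Finset (V × V)} {ω : Config E} {x : V} {y' : V'} :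
    Reach (mapArcs f arcs) ω (f x) y' ↔ ∃ y, y' = f y ∧ Reach arcs ω x y := by
  constructor
  · intro h
    induction h with
    | refl => exact ⟨x, rfl, reach_refl arcs ω x⟩
    | tail _ hstep ih =>
      obtain ⟨y, rfl, hxy⟩ := ih
      obtain ⟨z, rfl, hyz⟩ := openArc_mapArcs.1 hstep
      exact ⟨z, rfl, reach_trans hxy (reach_of_openArc hyz)⟩
  · rintro ⟨y, rfl, h⟩
    induction h with
    | refl => exact reach_refl _ ω _
    | tail _ hstep ih =>
      exact reach_trans ih (reach_of_openArc (openArc_mapArcs.2 ⟨_, rfl, hstep⟩))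

/-- Reachability between image vertices is unchanged. -/
lemma reach_mapArcs_iff {f : V ↪ V'} {arcs : E → Finset (V × V)} {ω : Config E} {x y : V} :
    Reach (mapArcs f arcs) ω (f x) (f y) ↔ Reach arcs ω x y := by
  rw [reach_mapArcs]
  constructor
  · rintro ⟨z, hz, h⟩
    rw [f.injective hz]
    exact h
  · intro h
    exact ⟨y, rfl, h⟩

/-- The forward-cluster event transports. -/
lemma fwdEvent_mapArcs (f : V ↪ V') (arcs : E → Finset (V × V)) (s v : V) :
    fwdEvent (mapArcs f arcs) (f s) (f v) = fwdEvent arcs s v := by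
  ext ω
  simp only [fwdEvent, Set.mem_setOf_eq, reach_mapArcs_iff]

/-- The backward-cluster event transports. -/
lemma bwdEvent_mapArcs (f : V ↪ V') (arcs : E → Finset (V × V)) (v : V) (T : Finset V) :
    bwdEvent (mapArcs f arcs) (f v) (T.map f) = bwdEvent arcs v T := by
  ext ω
  simp only [bwdEvent, Set.mem_setOf_eq]
  constructor
  · rintro ⟨t', ht', h⟩
    obtain ⟨t, ht, rfl⟩ := Finset.mem_map.1 ht'
    exact ⟨t, ht, reach_mapArcs_iff.1 h⟩
  · rintro ⟨t, ht, h⟩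
    exact ⟨f t, Finset.mem_map_of_mem f ht, reach_mapArcs_iff.2 h⟩

/-- The avoidance event transports. -/
lemma avoidEvent_mapArcs (f : V ↪ V') (arcs : E → Finset (V × V)) (s : V) (T : Finset V) :
    avoidEvent (mapArcs f arcs) (f s) (T.map f) = avoidEvent arcs s T := by
  ext ω
  simp only [avoidEvent, Set.mem_setOf_eq]
  constructor
  · intro h t ht hr
    exact h (f t) (Finset.mem_map_of_mem f ht) (reach_mapArcs_iff.2 hr)
  · intro h t' ht' hr
    obtain ⟨t, ht, rfl⟩ := Finset.mem_map.1 ht'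
    exact h t ht (reach_mapArcs_iff.1 hr)

/-- The gate event transports. -/
lemma gateEvent_mapArcs (f : V ↪ V') (arcs : E → Finset (V × V)) (s : V) (T : Finset V)
    (u w : V) :
    gateEvent (mapArcs f arcs) (f s) (T.map f) (f u) (f w) = gateEvent arcs s T u w := by
  rw [gateEvent_eq_union, gateEvent_eq_union, avoidEvent_mapArcs, fwdEvent_mapArcs,
    bwdEvent_mapArcs]

/-- The pivotal event transports. -/
lemma pivotalEvent_mapArcs (f : V ↪ V') (arcs : E → Finset (V × V)) (s : V) (T : Finset V)
    (u w : V) :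
    pivotalEvent (mapArcs f arcs) (f s) (T.map f) (f u) (f w) = pivotalEvent arcs s T u w := by
  unfold pivotalEvent
  rw [avoidEvent_mapArcs, fwdEvent_mapArcs, bwdEvent_mapArcs]

/-- `SameEnds` transports. -/
lemma sameEnds_mapArcs (f : V ↪ V') {arcs : E → Finset (V × V)} (hS : SameEnds arcs) :
    SameEnds (mapArcs f arcs) := by
  intro e xy hxy x'y' hx'y'
  obtain ⟨x, y, hx, hy, hxy⟩ := mem_mapArcs' hxy
  obtain ⟨x', y', hx', hy', hx'y'⟩ := mem_mapArcs' hx'y'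
  obtain ⟨h1, h2⟩ := hS e (x, y) hxy (x', y') hx'y'
  have h1' : x' = x ∨ x' = y := h1
  have h2' : y' = x ∨ y' = y := h2
  rw [hx, hy, hx', hy']
  constructor
  · rcases h1' with h | h
    · exact Or.inl (by rw [h])
    · exact Or.inr (by rw [h])
  · rcases h2' with h | h
    · exact Or.inl (by rw [h])
    · exact Or.inr (by rw [h])

/-- The core level transports. -/
lemma coreLevel_mapArcs [DecidableEq V] [DecidableEq V'] (f : V ↪ V') (arcs : E → Finset (V × V))
    (s : V) (C W : Finset V) :
    coreLevel (mapArcs f arcs) (f s) (C.map f) (W.map f) = coreLevel arcs s C W := by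
  ext ω
  rw [mem_coreLevel, mem_coreLevel]
  constructor
  · intro h z hz
    have := h (f z) (Finset.mem_map_of_mem f hz)
    rwa [Finset.mem_map', reach_mapArcs_iff] at this
  · intro h z' hz'
    obtain ⟨z, hz, rfl⟩ := Finset.mem_map.1 hz'
    rw [Finset.mem_map', reach_mapArcs_iff]
    exact h z hz

variable {R : Type*} [CommRing R]

/-- The marker indicator transports. -/
lemma marker_mapArcs (f : V ↪ V') (arcs : E → Finset (V × V)) (s a : V) :
    marker (R := R) (mapArcs f arcs) (f s) (f a) = marker arcs s a := by
  funext ω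
  unfold marker
  by_cases hr : Reach arcs ω s a
  · rw [if_pos hr, if_pos (reach_mapArcs_iff.2 hr)]
  · rw [if_neg hr, if_neg (fun h => hr (reach_mapArcs_iff.1 h))]

variable [Fintype E] [DecidableEq E]

/-- The cleared gate functional transports. -/
lemma phiC_gate_mapArcs (p : E → R) (f : V ↪ V') (arcs : E → Finset (V × V)) (s : V)
    (T : Finset V) (a b u w : V) :
    phiC p (mapArcs f arcs) (f s) (T.map f) (f a) (f b)
        (gateEvent (mapArcs f arcs) (f s) (T.map f) (f u) (f w)) =
      phiC p arcs s T a b (gateEvent arcs s T u w) := by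
  simp only [phiC, gateEvent_mapArcs, avoidEvent_mapArcs, marker_mapArcs]

/-- **Row 2′DARC is invariant under vertex embeddings** (relabelling the vertices, adding
isolated vertices): the one-arc gate statement holds in the pushed-forward system iff it holds
in the original. -/
theorem darc_mapArcs_iff [LinearOrder R] (p : E → R) (f : V ↪ V') (arcs : E → Finset (V × V))
    (s : V) (T : Finset V) (a b u w : V) :
    DARC p (mapArcs f arcs) (f s) (T.map f) (f a) (f b) (f u) (f w) ↔ DARC p arcs s T a b u w := by
  unfold DARC
  rw [phiC_gate_mapArcs]

end MapArcs

section OrTailKTransport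

variable {V V' : Type*} {E : Type*}
  {arcs : E → Finset (V × V)} {s : V} {U : Finset V} {ent : Finset V} {c : V → E} {a : V}

/-- An OR-tail structure transports along a vertex embedding (with any coin map `c'` agreeing
with `c` on the image of the entries). -/
lemma orTailK_mapArcs (f : V ↪ V') (h : OrTailK arcs s U ent c a) (c' : V' → E)
    (hc' : ∀ r ∈ ent, c' (f r) = c r) :
    OrTailK (mapArcs f arcs) (f s) (U.map f) (ent.map f) c' (f a) where
  ent_sub := Finset.map_subset_map.2 h.ent_sub
  s_notin := by rw [Finset.mem_map']; exact h.s_notin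
  a_notin := by rw [Finset.mem_map']; exact h.a_notin
  a_ne_s := fun e => h.a_ne_s (f.injective e)
  into_U := by
    intro e xy hxy hy
    obtain ⟨x, y, hx, hy', hxy⟩ := mem_mapArcs' hxy
    rw [hy', Finset.mem_map'] at hy
    rw [hx, Finset.mem_map']
    rcases h.into_U e (x, y) hxy hy with hx' | hx'
    · exact Or.inl hx'
    · exact Or.inr (by rw [show x = s from hx'])
  into_s := by
    intro e xy hxy hy
    obtain ⟨x, y, hx, hy', hxy⟩ := mem_mapArcs' hxy
    rw [hy'] at hy
    rw [hx, Finset.mem_map']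
    rcases h.into_s e (x, y) hxy (f.injective hy) with hx' | hx'
    · exact Or.inl hx'
    · exact Or.inr (by rw [show x = s from hx'])
  into_a := by
    intro e xy hxy hy
    obtain ⟨x, y, hx, hy', hxy⟩ := mem_mapArcs' hxy
    rw [hy'] at hy
    obtain ⟨r, hr, he, hx'⟩ := h.into_a e (x, y) hxy (f.injective hy)
    refine ⟨f r, Finset.mem_map_of_mem f hr, ?_, ?_⟩
    · rw [hc' r hr]; exact he
    · rw [hx, show x = r from hx']
  arcs_c := by
    intro r' hr'
    obtain ⟨r, hr, rfl⟩ := Finset.mem_map.1 hr'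
    rw [hc' r hr]
    unfold mapArcs
    rw [h.arcs_c r hr, Finset.map_singleton]
    rfl
  c_inj := by
    intro r' hr' r'' hr'' heq
    obtain ⟨r, hr, rfl⟩ := Finset.mem_map.1 hr'
    obtain ⟨r₂, hr₂, rfl⟩ := Finset.mem_map.1 hr''
    rw [hc' r hr, hc' r₂ hr₂] at heq
    rw [h.c_inj r hr r₂ hr₂ heq]

end OrTailKTransport

section Any

variable {V : Type*} {E : Type*} [Fintype V] [DecidableEq V] [Fintype E] [DecidableEq E]
  {R : Type*} [Field R] [LinearOrder R] [IsStrictOrderedRing R]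
  {arcs : E → Finset (V × V)} {s : V} {U : Finset V} {ent : Finset V} {c : V → E} {a w : V}

/-- **THEOREM (row 2′DARC at an OR-tail with ANY entry set and ARBITRARY coins — no spare-vertex
hypothesis).** `OrTailK arcs s U ent c a` with any entry set and any coin probabilities,
`SameEnds`, the cluster law of the core log-supermodular, ANY markers `m₁, m₂ ∈ U`, every head:
`Φ(s ↛ t in D + (a → w)) ≥ 0` for every probability vector.  Proof: push the system forward
along `Function.Embedding.inl : V ↪ V ⊕ V`, label the entries by their `Sum.inr` copies, apply
`darc_of_orTailK_coins`, transport back with `darc_mapArcs_iff`. -/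
theorem darc_of_orTailK_coins_any (pr : E → R) (hp : IsProbVec pr) (hS : SameEnds arcs)
    (h : OrTailK arcs s U ent c a) {m₁ m₂ : V} (hm₁ : m₁ ∈ U) (hm₂ : m₂ ∈ U)
    (hν : ∀ W W', W ⊆ U → W' ⊆ U →
      prob pr (coreLevel arcs s U W) * prob pr (coreLevel arcs s U W') ≤
        prob pr (coreLevel arcs s U (W ∩ W')) * prob pr (coreLevel arcs s U (W ∪ W')))
    {t : V} (htC : t ∉ insert a U) (hts : t ≠ s) (hws : w ≠ s) (hwC : w ∉ insert a U) :
    DARC pr arcs s {t} m₁ m₂ a w := by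
  classical
  let f : V ↪ V ⊕ V := Function.Embedding.inl
  have hf : ∀ x : V, f x = Sum.inl x := fun _ => rfl
  let c' : V ⊕ V → E := Sum.elim c c
  have hc' : ∀ r ∈ ent, c' (f r) = c r := fun _ _ => rfl
  have h' : OrTailK (mapArcs f arcs) (f s) (U.map f) (ent.map f) c' (f a) :=
    orTailK_mapArcs f h c' hc'
  have hS' : SameEnds (mapArcs f arcs) := sameEnds_mapArcs f hS
  let vt : V ⊕ V → V ⊕ V := fun v => Sum.inr (Sum.elim id id v)
  have hvt : ∀ r ∈ ent.map f, vt r ∉ U.map f ∧ vt r ≠ f a ∧ vt r ≠ f w := by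
    intro r hr
    obtain ⟨r₀, _, rfl⟩ := Finset.mem_map.1 hr
    refine ⟨?_, ?_, ?_⟩
    · intro hmem
      obtain ⟨x, _, hx⟩ := Finset.mem_map.1 hmem
      exact Sum.inl_ne_inr hx
    · exact Sum.inr_ne_inl
    · exact Sum.inr_ne_inl
  have hvtinj : ∀ r ∈ ent.map f, ∀ r' ∈ ent.map f, vt r = vt r' → r = r' := by
    intro r hr r' hr' heq
    obtain ⟨r₀, _, rfl⟩ := Finset.mem_map.1 hr
    obtain ⟨r₁, _, rfl⟩ := Finset.mem_map.1 hr'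
    have : r₀ = r₁ := Sum.inr_injective heq
    rw [this]
  have hν' : ∀ W W', W ⊆ U.map f → W' ⊆ U.map f →
      prob pr (coreLevel (mapArcs f arcs) (f s) (U.map f) W) *
          prob pr (coreLevel (mapArcs f arcs) (f s) (U.map f) W') ≤
        prob pr (coreLevel (mapArcs f arcs) (f s) (U.map f) (W ∩ W')) *
          prob pr (coreLevel (mapArcs f arcs) (f s) (U.map f) (W ∪ W')) := by
    intro W W' hW hW'
    obtain ⟨W₀, hW₀, rfl⟩ := Finset.subset_map_iff.1 hW
    obtain ⟨W₁, hW₁, rfl⟩ := Finset.subset_map_iff.1 hW'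
    rw [← Finset.map_inter, ← Finset.map_union, coreLevel_mapArcs, coreLevel_mapArcs,
      coreLevel_mapArcs, coreLevel_mapArcs]
    exact hν W₀ W₁ hW₀ hW₁
  have hins : ∀ x : V, f x ∈ insert (f a) (U.map f) ↔ x ∈ insert a U := by
    intro x
    rw [Finset.mem_insert, Finset.mem_insert, Finset.mem_map']
    constructor
    · rintro (hx | hx)
      · exact Or.inl (f.injective hx)
      · exact Or.inr hx
    · rintro (hx | hx)
      · exact Or.inl (by rw [hx])
      · exact Or.inr hx
  have htC' : f t ∉ insert (f a) (U.map f) := by rw [hins]; exact htC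
  have hwC' : f w ∉ insert (f a) (U.map f) := by rw [hins]; exact hwC
  have hts' : f t ≠ f s := fun e => hts (f.injective e)
  have hws' : f w ≠ f s := fun e => hws (f.injective e)
  have key := darc_of_orTailK_coins (V := V ⊕ V) pr hp hS' h' (Finset.mem_map_of_mem f hm₁)
    (Finset.mem_map_of_mem f hm₂) vt hvt hvtinj hν' htC' hts' hws' hwC'
  have hiff := darc_mapArcs_iff pr f arcs s {t} m₁ m₂ a w
  rw [Finset.map_singleton] at hiff
  exact hiff.1 key

/-- **COROLLARY (out-tree core, any entry set, arbitrary coins, no spare-vertex hypothesis).** -/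
theorem darc_of_orTailTreeK_coins_any (pr : E → R) (hp : IsProbVec pr) (hS : SameEnds arcs)
    (h : OrTailK arcs s U ent c a) {c' : V → E} {par : V → V} {rk : V → ℕ}
    (hT : TreeCore arcs s U c' par rk) {m₁ m₂ : V} (hm₁ : m₁ ∈ U) (hm₂ : m₂ ∈ U)
    {t : V} (htC : t ∉ insert a U) (hts : t ≠ s) (hws : w ≠ s) (hwC : w ∉ insert a U) :
    DARC pr arcs s {t} m₁ m₂ a w :=
  darc_of_orTailK_coins_any pr hp hS h hm₁ hm₂ (hT.coreLevel_lsm pr hp) htC hts hws hwC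

end Any

end Summit.Ventures.PercRepro2.Coin
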